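import Literature.Topology.FourManifolds.GenericMapSphereStructure
import Literature.Topology.FourManifolds.FoldLocusArc
import Literature.Topology.FourManifolds.CuspLocusArc
import HarnessLib

/-!
# The singular locus of a generic map `M⁴ → S²` is a compact union of smooth arcs

Topic `Literature/Topology/FourManifolds` (programme of the fact
`Literature.Topology.FourManifolds.exists_isSimplifiedBrokenLefschetzFibration`, Baykur–Saeki 2017, §2.1
p. 6: *"the singular set of a generic map is a smooth 1-dimensional submanifold (a finite union
of circles on a closed `X`), consisting of folds and finitely many cusps, and `f` restricted to
the folds is an immersion"*).  Final packaging of the lane's singular-locus results: a `C^∞`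
map `g : M → S²` with a finite cusp set `S`, fold charts off `S`, compact critical set, and
through EVERY critical point a `C^∞` injective arc of critical points containing all nearby
critical points — immersed by `g` when the point is a fold point.

* **`exists_generic_map_sphere_arcs`**.

Everything is proved; no definitions, no named facts (D-0026).

## References

* R. İ. Baykur, O. Saeki, *Simplifying indefinite fibrations on 4-manifolds*, arXiv:1705.11169,
  §2.1 p. 6, §6 p. 19. [BaykurSaeki2017]
* M. Golubitsky, V. Guillemin, *Stable Mappings and Their Singularities*, GTM 14 (1973), Ch. III
  §4 Thm. 4.5; Ch. VI §2. [GolubitskyGuillemin1973]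
-/

noncomputable section

open Set Function Filter Module
open scoped ContDiff Topology Manifold

namespace Literature.Topology.FourManifolds

/-- Local notation for this file: the model space `ℝⁿ = EuclideanSpace ℝ (Fin n)`. -/
local notation "𝔼 " n:arg => EuclideanSpace ℝ (Fin n)

/-- Local notation: the round 2-sphere. -/
local notation "𝕊²" => Metric.sphere (0 : EuclideanSpace ℝ (Fin 3)) 1

/-- **The singular locus of a generic map `M⁴ → S²` is a union of smooth arcs.**  Every compact
boundaryless `C^∞` 4-manifold carries a `C^∞` map `g : M → S²` and a finite set `S ⊆ M`
(cusps with Whitney data) such that every critical point off `S` is a fold point with charts,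
the critical set is compact, and through every critical point `p` there is a `C^∞` injective
arc `γ : (-δ, δ) → M` of critical points, `γ 0 = p`, containing every critical point near `p`,
with `g ∘ γ` an immersion when `p ∉ S`. [cite: BaykurSaeki2017, §2.1 p. 6, §6 p. 19] -/
theorem exists_generic_map_sphere_arcs (M : Type*) [TopologicalSpace M] [T2Space M]
    [CompactSpace M] [ChartedSpace (𝔼 4) M] [IsManifold (𝓡 4) ∞ M] :
    ∃ g : M → 𝕊², ContMDiff (𝓡 4) (𝓡 2) ∞ g ∧ ∃ S : Finset M,
      (∀ p ∈ S, HasManifoldWhitneyCuspCharts g p) ∧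
      (∀ p : M, ¬ Surjective (mfderiv (𝓡 4) (𝓡 2) g p) → p ∉ S → HasManifoldFoldChart g p) ∧
      IsCompact {p : M | ¬ Surjective (mfderiv (𝓡 4) (𝓡 2) g p)} ∧
      ∀ p : M, ¬ Surjective (mfderiv (𝓡 4) (𝓡 2) g p) →
        ∃ (δ : ℝ) (γ : ℝ → M), 0 < δ ∧ γ 0 = p ∧
          ContMDiffOn 𝓘(ℝ, ℝ) (𝓡 4) ∞ γ (Ioo (-δ) δ) ∧ InjOn γ (Ioo (-δ) δ) ∧
          (∀ x ∈ Ioo (-δ) δ, ¬ Surjective (mfderiv (𝓡 4) (𝓡 2) g (γ x))) ∧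
          (∃ U ∈ 𝓝 p, ∀ q ∈ U, ¬ Surjective (mfderiv (𝓡 4) (𝓡 2) g q) → q ∈ γ '' Ioo (-δ) δ) ∧
          (p ∉ S → ∀ x ∈ Ioo (-δ) δ, Injective (mfderiv 𝓘(ℝ, ℝ) (𝓡 2) (g ∘ γ) x)) := by
  obtain ⟨g, hg, S, hS, hfold, hcomp, -⟩ := exists_generic_map_sphere_structured M
  refine ⟨g, hg, S, hS, hfold, hcomp, fun p hp => ?_⟩
  by_cases hpS : p ∈ S
  · obtain ⟨δ, γ, hδ, h0, hs, hinj, hcrit, hU⟩ := (hS p hpS).exists_arc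
    exact ⟨δ, γ, hδ, h0, hs, hinj, hcrit, hU, fun h => absurd hpS h⟩
  · obtain ⟨δ, γ, hδ, h0, hs, hinj, hcrit, hU, himm⟩ := (hfold p hp hpS).exists_arc
    exact ⟨δ, γ, hδ, h0, hs, hinj, hcrit, hU, fun _ => himm⟩

end Literature.Topology.FourManifolds
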